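import Mathlib
import Summits.SmoothPoincare4.SmoothPoincare4.Theorems.SullivanDualAdmissibleJExists
import Summits.SmoothPoincare4.SmoothPoincare4.Theorems.SullivanDualAdmissibleJExistsCoframes
import Literature.Geometry.Manifold.OpenSubmanifoldMFDeriv
import HarnessLib

/-!
# Crux `HyperbolicEnd` (stmt-SmoothPoincare4-7825), line `Sketch` — stub `stub_glueFromChart`
# (G2, glue from the chart)

Gluing of a filled flat certificate `(Ĵ', F̂', c')` on the chart ball `B(e_q q, r₃)`, linked to
`(J, F)` on the outer shell, with the puncture-certificate pair `(J, F)` off `e_q⁻¹ B̄(e_q q, r₂)`: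
a hyperbolic pair on the whole core with constant `min c c'` (§4). Preliminaries: §1 the
smoothness clause (reading in tangent coordinates) is local in the field, and conjugates
`Ψ⁻¹ ĵ(·) Ψ` of SMOOTH FIELDS `ĵ` by smooth invertible coframes read smoothly; §2 the chart map
`e_q ∘ val` of `M ∖ {p}` (smooth, invertible differential) and chart expressions of smooth maps
`U → M ∖ {p}`, `U ⊆ ℂ` open; §3 the curvature certificate `λ ∈ C², 2c λ³ ≤ λ Δλ - |∇λ|²` glues
along open covers (`Δ` and `fderiv` only see germs).
-/

noncomputable section

-- the prescribed crux namespace repeats the component `SmoothPoincare4`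
set_option linter.dupNamespace false

open scoped Manifold ContDiff Topology
open Laplacian Set Filter Function ContinuousLinearMap
open Literature.Geometry.Symplectic Literature.Topology.FourManifolds Literature.Geometry.Manifold
open Summit.SmoothPoincare4.SmoothPoincare4.Theorems.SullivanDual

namespace Summit.SmoothPoincare4.SmoothPoincare4.Cruxes.HyperbolicEnd.Sketch

/-! ### §1 Readings in tangent coordinates: locality, conjugation by a smooth field -/

section Readings

variable {EN : Type*} [NormedAddCommGroup EN] [NormedSpace ℝ EN]
  {HN : Type*} [TopologicalSpace HN] {I : ModelWithCorners ℝ EN HN}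
  {N : Type*} [TopologicalSpace N] [ChartedSpace HN N] [IsManifold I ∞ N]
  {F : Type*} [NormedAddCommGroup F] [NormedSpace ℝ F]

/-- **Locality of the smoothness clause.** If two fields of endomorphisms of `TN` agree on an
open set containing `x₀`, their readings in tangent coordinates at `x₀` are `C^n` at `x₀`
together (the reading at `x` only sees the field at `x`). [folklore] -/
theorem contMDiffAt_inTangentCoordinates_congr_of_isOpen {n : ℕ∞ω} {ϕ ϕ' : N → EN →L[ℝ] EN}
    {D : Set N} (hD : IsOpen D) {x₀ : N} (hx₀ : x₀ ∈ D) (h : ∀ x ∈ D, ϕ x = ϕ' x)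
    (hϕ' : ContMDiffAt I 𝓘(ℝ, EN →L[ℝ] EN) n
      (inTangentCoordinates I I (id : N → N) id ϕ' x₀) x₀) :
    ContMDiffAt I 𝓘(ℝ, EN →L[ℝ] EN) n (inTangentCoordinates I I (id : N → N) id ϕ x₀) x₀ := by
  refine hϕ'.congr_of_eventuallyEq ?_
  filter_upwards [hD.mem_nhds hx₀] with x hx
  simp only [inTangentCoordinates, h x hx]

variable [CompleteSpace EN]

/-- **Smoothness of the conjugate of a smooth field by a coframe.** For a coframe
`Ψ_x : T_x N → F` whose reading in tangent coordinates at `x₀` is `C^∞` at `x₀`, `Ψ_{x₀}`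
invertible, and a field `ĵ : N → End F` `C^∞` at `x₀`, the reading of `x ↦ Ψ_x⁻¹ ĵ(x) Ψ_x` at
`x₀` is `C^∞` at `x₀`: on the chart domain it is `G(x)⁻¹ ĵ(x) G(x)` for the reading `G` of `Ψ`
(cocycle rule), and inversion is smooth at the invertible `G(x₀)`. [folklore] -/
theorem contMDiffAt_inTangentCoordinates_conj_field (j : N → F →L[ℝ] F)
    (Ψ : N → EN →L[ℝ] F) (g : N → F) {x₀ : N}
    (hj : ContMDiffAt I 𝓘(ℝ, F →L[ℝ] F) ∞ j x₀)
    (hΨ : ContMDiffAt I 𝓘(ℝ, EN →L[ℝ] F) ∞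
      (inTangentCoordinates I 𝓘(ℝ, F) (id : N → N) g Ψ x₀) x₀)
    (hinv : (Ψ x₀).IsInvertible) :
    ContMDiffAt I 𝓘(ℝ, EN →L[ℝ] EN) ∞
      (inTangentCoordinates I I (id : N → N) id
        (fun x => (Ψ x).inverse ∘L j x ∘L Ψ x) x₀) x₀ := by
  -- adapted from `contMDiffAt_inTangentCoordinates_conj` (SullivanDualAdmissibleJExists.lean)
  set G : N → EN →L[ℝ] F := inTangentCoordinates I 𝓘(ℝ, F) (id : N → N) g Ψ x₀ with hG
  have hcomp : ContMDiffAt I 𝓘(ℝ, EN →L[ℝ] EN) ∞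
      (fun x => (G x).inverse ∘L (j x ∘L G x)) x₀ :=
    (contMDiffAt_inverse_inTangentCoordinates_coframe Ψ g hΨ hinv).clm_comp (hj.clm_comp hΨ)
  refine hcomp.congr_of_eventuallyEq ?_
  filter_upwards [(chartAt HN x₀).open_source.mem_nhds (mem_chart_source HN x₀)] with x hx
  have hx' : x ∈ (extChartAt I x₀).source := by rwa [extChartAt_source]
  obtain ⟨e, he, hes⟩ := exists_equiv_tangentCoordChange (I := I) hx'
  rw [inTangentCoordinates_eq _ _ _ hx hx, hG, inTangentCoordinates_coframe_eq Ψ g hx, ← he,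
    conj_comp_equiv, hes, he]
  rfl

end Readings

/-! ### §2 The chart map `e_q ∘ val` of `M ∖ {p}` -/

section ChartMap

variable {M : Type*} [TopologicalSpace M] [T2Space M] [ChartedSpace (EuclideanSpace ℝ (Fin 4)) M]
  [IsManifold (𝓡 4) ∞ M]

/-- `e_q ∘ val` is `C^∞` on `M ∖ {p}` over the chart domain of `q`. [folklore] -/
theorem contMDiffAt_extChartAt_comp_val (p q : M) {x : punctured p}
    (hx : x.1 ∈ (extChartAt (𝓡 4) q).source) :
    ContMDiffAt (𝓡 4) (𝓡 4) ∞ (fun z : punctured p => extChartAt (𝓡 4) q z.1) x :=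
  (contMDiffAt_extChartAt' (n := ∞) (by rwa [extChartAt_source] at hx)).comp x
    (contMDiff_subtype_val x)

/-- The differential of `e_q ∘ val` at a point of `M ∖ {p}` over the chart domain of `q` is
that of `e_q` (the inclusion of the open submanifold has identity differential), hence
invertible. [folklore] -/
theorem isInvertible_mfderiv_extChartAt_comp_val (p q : M) {x : punctured p}
    (hx : x.1 ∈ (extChartAt (𝓡 4) q).source) :
    (mfderiv (𝓡 4) (𝓡 4) (fun z : punctured p => extChartAt (𝓡 4) q z.1) x).IsInvertible := by
  have h : mfderiv (𝓡 4) (𝓡 4) (fun z : punctured p => extChartAt (𝓡 4) q z.1) x =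
      mfderiv (𝓡 4) (𝓡 4) (extChartAt (𝓡 4) q) x.1 :=
    ((mdifferentiableAt_extChartAt (by rwa [extChartAt_source] at hx)).hasMFDerivAt.comp x
      (OpenSubmanifold.hasMFDerivAt_subtype_val x)).mfderiv.trans (ext fun v => rfl)
  exact h ▸ isInvertible_mfderiv_extChartAt hx

/-- **Chart expressions of smooth maps into `M ∖ {p}`.** For a `C^∞` map `f : U → M ∖ {p}`,
`U ⊆ ℂ` open, and an open piece `D` of `M ∖ {p}` over the chart domain of `q`: `U ∩ f⁻¹(D)` is
open and `e_q ∘ f` is `C^∞` on it with derivative `d(e_q ∘ val)_{f z} ∘ df_z`. [folklore] -/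
theorem contDiffOn_extChartAt_comp_jcurve (p q : M) {U : Set ℂ} {f : ℂ → punctured p}
    (hU : IsOpen U) (hf : ContMDiffOn 𝓘(ℝ, ℂ) (𝓡 4) ∞ f U) {D : Set (punctured p)}
    (hD : IsOpen D) (hDs : ∀ x ∈ D, x.1 ∈ (extChartAt (𝓡 4) q).source) :
    IsOpen (U ∩ f ⁻¹' D) ∧
    ContDiffOn ℝ ∞ (fun w => extChartAt (𝓡 4) q (f w).1) (U ∩ f ⁻¹' D) ∧
    ∀ z ∈ U ∩ f ⁻¹' D, ∀ ζ : ℂ, fderiv ℝ (fun w => extChartAt (𝓡 4) q (f w).1) z ζ =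
      mfderiv (𝓡 4) (𝓡 4) (fun z : punctured p => extChartAt (𝓡 4) q z.1) (f z)
        (mfderiv 𝓘(ℝ, ℂ) (𝓡 4) f z ζ) := by
  have hfz : ∀ z ∈ U ∩ f ⁻¹' D, ContMDiffAt 𝓘(ℝ, ℂ) (𝓡 4) ∞ f z :=
    fun z hz => (hf z hz.1).contMDiffAt (hU.mem_nhds hz.1)
  refine ⟨hf.continuousOn.isOpen_inter_preimage hU hD, contMDiffOn_iff_contDiffOn.mp
    fun z hz => ((contMDiffAt_extChartAt_comp_val p q (hDs _ hz.2)).comp z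
      (hfz z hz)).contMDiffWithinAt, fun z hz ζ => ?_⟩
  rw [← mfderiv_eq_fderiv]
  exact congrArg (fun L => L ζ) (mfderiv_comp z
    ((contMDiffAt_extChartAt_comp_val p q (hDs _ hz.2)).mdifferentiableAt (by simp))
    ((hfz z hz).mdifferentiableAt (by simp)))

end ChartMap

/-! ### §3 The curvature certificate is local -/

/-- **Certificates glue along an open cover.** If `U ⊆ U₁ ∪ U₂` (`Uᵢ ⊆ ℂ` open) and `λ`
agrees on `Uᵢ` with a nonnegative `C²` density `λᵢ` with `2cᵢ λᵢ³ ≤ λᵢ Δλᵢ - |∇λᵢ|²` on `Uᵢ`,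
then `λ` is `C²` on `U` with `2 min(c₁,c₂) λ³ ≤ λ Δλ - |∇λ|²` there: `C²` is local, the value,
`fderiv` and `Δ` at a point only see the germ, and `min(c₁,c₂) λ³ ≤ cᵢ λ³`. [folklore] -/
theorem certificate_glue_of_cover {U U₁ U₂ : Set ℂ} {lam lam₁ lam₂ : ℂ → ℝ} {c₁ c₂ : ℝ}
    (hU₁ : IsOpen U₁) (hU₂ : IsOpen U₂) (hU : U ⊆ U₁ ∪ U₂)
    (hC₁ : ContDiffOn ℝ 2 lam₁ U₁) (hC₂ : ContDiffOn ℝ 2 lam₂ U₂)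
    (hineq₁ : ∀ z ∈ U₁, 2 * c₁ * lam₁ z ^ 3 ≤
      lam₁ z * (Δ lam₁) z - ((fderiv ℝ lam₁ z 1) ^ 2 + (fderiv ℝ lam₁ z Complex.I) ^ 2))
    (hineq₂ : ∀ z ∈ U₂, 2 * c₂ * lam₂ z ^ 3 ≤
      lam₂ z * (Δ lam₂) z - ((fderiv ℝ lam₂ z 1) ^ 2 + (fderiv ℝ lam₂ z Complex.I) ^ 2))
    (h₁ : EqOn lam lam₁ U₁) (h₂ : EqOn lam lam₂ U₂)
    (hpos₁ : ∀ z ∈ U₁, 0 ≤ lam₁ z) (hpos₂ : ∀ z ∈ U₂, 0 ≤ lam₂ z) :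
    ContDiffOn ℝ 2 lam U ∧
    ∀ z ∈ U, 2 * min c₁ c₂ * lam z ^ 3 ≤
      lam z * (Δ lam) z - ((fderiv ℝ lam z 1) ^ 2 + (fderiv ℝ lam z Complex.I) ^ 2) := by
  -- transfer of the inequality along a germ, weakening the constant
  have key : ∀ {V : Set ℂ} {μ : ℂ → ℝ} {c' : ℝ}, IsOpen V → EqOn lam μ V → (∀ z ∈ V, 0 ≤ μ z) →
      min c₁ c₂ ≤ c' → (∀ z ∈ V, 2 * c' * μ z ^ 3 ≤
        μ z * (Δ μ) z - ((fderiv ℝ μ z 1) ^ 2 + (fderiv ℝ μ z Complex.I) ^ 2)) →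
      ∀ z ∈ V, 2 * min c₁ c₂ * lam z ^ 3 ≤
        lam z * (Δ lam) z - ((fderiv ℝ lam z 1) ^ 2 + (fderiv ℝ lam z Complex.I) ^ 2) := by
    intro V μ c' hV hEq hμ hc hineq z hz
    have hev : lam =ᶠ[𝓝 z] μ := eventuallyEq_of_mem (hV.mem_nhds hz) hEq
    rw [hev.eq_of_nhds, hev.fderiv_eq, (InnerProductSpace.laplacian_congr_nhds hev).eq_of_nhds]
    exact (mul_le_mul_of_nonneg_right (mul_le_mul_of_nonneg_left hc zero_le_two)
      (pow_nonneg (hμ z hz) 3)).trans (hineq z hz)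
  refine ⟨contDiffOn_of_locally_contDiffOn fun z hz => ?_, fun z hz => ?_⟩
  · rcases hU hz with hz₁ | hz₂
    · exact ⟨U₁, hU₁, hz₁, (hC₁.congr h₁).mono inter_subset_right⟩
    · exact ⟨U₂, hU₂, hz₂, (hC₂.congr h₂).mono inter_subset_right⟩
  · rcases hU hz with hz₁ | hz₂
    · exact key hU₁ h₁ hpos₁ (min_le_left _ _) hineq₁ z hz₁
    · exact key hU₂ h₂ hpos₂ (min_le_right _ _) hineq₂ z hz₂

/-! ### §4 The stub: glue from the chart -/

/-- **Stub G2 — glue from the chart.** With `D₃ = {x | e_q x ∈ B(e_q q, r₃)}` (open) and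
`C = e_q⁻¹ B̄(e_q q, r₂)` (closed: a compact chart piece), put `J'' = A⁻¹ Ĵ'(e_q ·) A`,
`F'' = F̂'(e_q ·)(A ·)` on `D₃` (`A_x = d(e_q ∘ val)_x`) and `(J, F)` off `D₃`; by the link the
two agree on `D₃ ∖ C`, so `(J'', F'') = (J, F)` off `C`. Hence `J''² = -1` (`conj_conj`), the
reading of `J''` is smooth (locally that of `J`, or of the conjugate of the smooth field
`Ĵ' ∘ e_q` by the smooth invertible coframe `A`, `contMDiffAt_inTangentCoordinates_conj_field`),
`J'' = J` is standard on `B_ε'` (the chart ball lies in the core), `F''` is positive definite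
(`A_x` is injective), and along a local `J''`-curve `f : U → core` the density is certified
with `min c c'`: on `U ∩ f⁻¹(Cᶜ)` `f` is a `J`-curve avoiding the inner ball, on `U ∩ f⁻¹(D₃)`
`e_q ∘ f` is a flat `Ĵ'`-curve into the ball with the same density; certificates glue. -/
theorem stub_glueFromChart :
    ∀ (S : HomotopySphere 4) (p : S.carrier)
    (J : ∀ x : ↥(punctured p), TangentSpace (𝓡 4) x →L[ℝ] TangentSpace (𝓡 4) x) (ε' : ℝ)
    (F : ∀ x : ↥(punctured p), TangentSpace (𝓡 4) x → ℝ) (c : ℝ) (q : S.carrier) (r₁ r₃ : ℝ),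
    (0 < ε' ∧ Metric.closedBall (extChartAt (𝓡 4) p p) ε' ⊆ (extChartAt (𝓡 4) p).target ∧
      (∀ (x : ↥(punctured p)) (v : TangentSpace (𝓡 4) x), J x (J x v) = -v) ∧
      (∀ x₀ : ↥(punctured p), ContMDiffAt (𝓡 4)
        𝓘(ℝ, EuclideanSpace ℝ (Fin 4) →L[ℝ] EuclideanSpace ℝ (Fin 4)) ∞
        (inTangentCoordinates (𝓡 4) (𝓡 4) (id : ↥(punctured p) → ↥(punctured p)) id
          (fun x => J x) x₀) x₀) ∧
      (∀ x : ↥(punctured p), InPuncturedChartBall p ε' x →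
        ∀ (v : TangentSpace (𝓡 4) x) (b : EuclideanSpace ℝ (Fin 4)),
          inner ℝ (fderiv ℝ inversion (extChartAt (𝓡 4) p x.1 - extChartAt (𝓡 4) p p)
            (mfderiv (𝓡 4) 𝓘(ℝ, EuclideanSpace ℝ (Fin 4))
              (fun z : ↥(punctured p) => extChartAt (𝓡 4) p z.1) x (J x v))) b =
          stdSymplecticForm (fderiv ℝ inversion (extChartAt (𝓡 4) p x.1 - extChartAt (𝓡 4) p p)
            (mfderiv (𝓡 4) 𝓘(ℝ, EuclideanSpace ℝ (Fin 4))
              (fun z : ↥(punctured p) => extChartAt (𝓡 4) p z.1) x v)) b) ∧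
      0 < c ∧ 0 < r₁ ∧ r₁ < r₃ ∧
      Metric.closedBall (extChartAt (𝓡 4) q q) r₃ ⊆ (extChartAt (𝓡 4) q).target ∧
      (∀ y ∈ Metric.closedBall (extChartAt (𝓡 4) q q) r₃, (extChartAt (𝓡 4) q).symm y ≠ p) ∧
      (∀ x : ↥(punctured p), x.1 ∈ (chartAt (EuclideanSpace ℝ (Fin 4)) q).source →
        extChartAt (𝓡 4) q x.1 ∈ Metric.closedBall (extChartAt (𝓡 4) q q) r₃ →
        ¬ InPuncturedChartBall p ε' x) ∧
      ContMDiff (𝓡 4).tangent 𝓘(ℝ, ℝ) ∞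
        (fun v : TangentBundle (𝓡 4) ↥(punctured p) => F v.proj v.snd) ∧
      (∀ (x : ↥(punctured p)) (v : TangentSpace (𝓡 4) x), 0 ≤ F x v ∧ (F x v = 0 → v = 0)) ∧
      (∀ (U : Set ℂ) (f : ℂ → ↥(punctured p)), IsOpen U →
        ContMDiffOn 𝓘(ℝ, ℂ) (𝓡 4) ∞ f U →
        (∀ z ∈ U, ∀ ζ : ℂ, mfderiv 𝓘(ℝ, ℂ) (𝓡 4) f z (Complex.I * ζ : ℂ) =
          J (f z) (mfderiv 𝓘(ℝ, ℂ) (𝓡 4) f z (ζ : ℂ))) →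
        (∀ z ∈ U, ¬ InPuncturedChartBall p ε' (f z)) →
        (∀ z ∈ U, (f z).1 ∈ (chartAt (EuclideanSpace ℝ (Fin 4)) q).source →
            extChartAt (𝓡 4) q (f z).1 ∉ Metric.closedBall (extChartAt (𝓡 4) q q) r₁) →
        ContDiffOn ℝ 2 (fun w => F (f w) (mfderiv 𝓘(ℝ, ℂ) (𝓡 4) f w (1 : ℂ))) U ∧
        ∀ z ∈ U, 2 * c * (F (f z) (mfderiv 𝓘(ℝ, ℂ) (𝓡 4) f z (1 : ℂ))) ^ 3 ≤
          F (f z) (mfderiv 𝓘(ℝ, ℂ) (𝓡 4) f z (1 : ℂ)) *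
              (Δ (fun w => F (f w) (mfderiv 𝓘(ℝ, ℂ) (𝓡 4) f w (1 : ℂ)))) z -
            ((fderiv ℝ (fun w => F (f w) (mfderiv 𝓘(ℝ, ℂ) (𝓡 4) f w (1 : ℂ))) z 1) ^ 2 +
              (fderiv ℝ (fun w => F (f w) (mfderiv 𝓘(ℝ, ℂ) (𝓡 4) f w (1 : ℂ))) z Complex.I) ^ 2))) →
    ∀ (r₂ c' : ℝ)
      (Jh' : EuclideanSpace ℝ (Fin 4) → EuclideanSpace ℝ (Fin 4) →L[ℝ] EuclideanSpace ℝ (Fin 4))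
      (Fh' : EuclideanSpace ℝ (Fin 4) → EuclideanSpace ℝ (Fin 4) → ℝ), r₁ < r₂ → r₂ < r₃ → 0 < c' →
    ContDiffOn ℝ ∞ Jh' (Metric.ball (extChartAt (𝓡 4) q q) r₃) →
    (∀ x ∈ Metric.ball (extChartAt (𝓡 4) q q) r₃, ∀ v, Jh' x (Jh' x v) = -v) →
    (∀ x ∈ Metric.ball (extChartAt (𝓡 4) q q) r₃, ∀ v, 0 ≤ Fh' x v ∧ (Fh' x v = 0 → v = 0)) →
    (∀ (U : Set ℂ) (g : ℂ → EuclideanSpace ℝ (Fin 4)), IsOpen U →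
      ContDiffOn ℝ ∞ g U →
      (∀ z ∈ U, ∀ ζ : ℂ,
        fderiv ℝ g z (Complex.I * ζ) = Jh' (g z) (fderiv ℝ g z ζ)) →
      (∀ z ∈ U, g z ∈
        Metric.ball (extChartAt (𝓡 4) q q) r₃) →
      ContDiffOn ℝ 2 (fun w => Fh' (g w) (fderiv ℝ g w 1)) U ∧
      ∀ z ∈ U, 2 * c' * (Fh' (g z) (fderiv ℝ g z 1)) ^ 3 ≤
        Fh' (g z) (fderiv ℝ g z 1) * (Δ (fun w => Fh' (g w) (fderiv ℝ g w 1))) z -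
          ((fderiv ℝ (fun w => Fh' (g w) (fderiv ℝ g w 1)) z 1) ^ 2 +
            (fderiv ℝ (fun w => Fh' (g w) (fderiv ℝ g w 1)) z Complex.I) ^ 2)) →
    (∀ x : ↥(punctured p), x.1 ∈ (chartAt (EuclideanSpace ℝ (Fin 4)) q).source →
      extChartAt (𝓡 4) q x.1 ∈
        Metric.ball (extChartAt (𝓡 4) q q) r₃ \ Metric.closedBall (extChartAt (𝓡 4) q q) r₂ →
      ∀ v : TangentSpace (𝓡 4) x,
        Jh' (extChartAt (𝓡 4) q x.1)
          (mfderiv (𝓡 4) 𝓘(ℝ, EuclideanSpace ℝ (Fin 4))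
          (fun z : ↥(punctured p) => extChartAt (𝓡 4) q z.1) x v) =
        mfderiv (𝓡 4) 𝓘(ℝ, EuclideanSpace ℝ (Fin 4))
          (fun z : ↥(punctured p) => extChartAt (𝓡 4) q z.1) x (J x v) ∧
        Fh' (extChartAt (𝓡 4) q x.1)
          (mfderiv (𝓡 4) 𝓘(ℝ, EuclideanSpace ℝ (Fin 4))
          (fun z : ↥(punctured p) => extChartAt (𝓡 4) q z.1) x v) = F x v) →
    ∃ (J : ∀ x : ↥(punctured p), TangentSpace (𝓡 4) x →L[ℝ] TangentSpace (𝓡 4) x) (ε' c : ℝ)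
      (F : ∀ x : ↥(punctured p), TangentSpace (𝓡 4) x → ℝ),
      0 < ε' ∧ Metric.closedBall (extChartAt (𝓡 4) p p) ε' ⊆ (extChartAt (𝓡 4) p).target ∧
      (∀ (x : ↥(punctured p)) (v : TangentSpace (𝓡 4) x), J x (J x v) = -v) ∧
      (∀ x₀ : ↥(punctured p), ContMDiffAt (𝓡 4)
        𝓘(ℝ, EuclideanSpace ℝ (Fin 4) →L[ℝ] EuclideanSpace ℝ (Fin 4)) ∞
        (inTangentCoordinates (𝓡 4) (𝓡 4) (id : ↥(punctured p) → ↥(punctured p)) id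
          (fun x => J x) x₀) x₀) ∧
      (∀ x : ↥(punctured p), InPuncturedChartBall p ε' x →
        ∀ (v : TangentSpace (𝓡 4) x) (b : EuclideanSpace ℝ (Fin 4)),
          inner ℝ (fderiv ℝ inversion (extChartAt (𝓡 4) p x.1 - extChartAt (𝓡 4) p p)
            (mfderiv (𝓡 4) 𝓘(ℝ, EuclideanSpace ℝ (Fin 4))
              (fun z : ↥(punctured p) => extChartAt (𝓡 4) p z.1) x (J x v))) b =
          stdSymplecticForm (fderiv ℝ inversion (extChartAt (𝓡 4) p x.1 - extChartAt (𝓡 4) p p)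
            (mfderiv (𝓡 4) 𝓘(ℝ, EuclideanSpace ℝ (Fin 4))
              (fun z : ↥(punctured p) => extChartAt (𝓡 4) p z.1) x v)) b) ∧
      0 < c ∧
      (∀ x : ↥(punctured p), ¬ InPuncturedChartBall p ε' x →
        ∀ v : TangentSpace (𝓡 4) x, 0 ≤ F x v ∧ (F x v = 0 → v = 0)) ∧
      (∀ (U : Set ℂ) (f : ℂ → ↥(punctured p)), IsOpen U →
        ContMDiffOn 𝓘(ℝ, ℂ) (𝓡 4) ∞ f U →
        (∀ z ∈ U, ∀ ζ : ℂ, mfderiv 𝓘(ℝ, ℂ) (𝓡 4) f z (Complex.I * ζ : ℂ) =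
          J (f z) (mfderiv 𝓘(ℝ, ℂ) (𝓡 4) f z (ζ : ℂ))) →
        (∀ z ∈ U, ¬ InPuncturedChartBall p ε' (f z)) →
        ContDiffOn ℝ 2 (fun w => F (f w) (mfderiv 𝓘(ℝ, ℂ) (𝓡 4) f w (1 : ℂ))) U ∧
        ∀ z ∈ U, 2 * c * (F (f z) (mfderiv 𝓘(ℝ, ℂ) (𝓡 4) f z (1 : ℂ))) ^ 3 ≤
          F (f z) (mfderiv 𝓘(ℝ, ℂ) (𝓡 4) f z (1 : ℂ)) *
              (Δ (fun w => F (f w) (mfderiv 𝓘(ℝ, ℂ) (𝓡 4) f w (1 : ℂ)))) z -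
            ((fderiv ℝ (fun w => F (f w) (mfderiv 𝓘(ℝ, ℂ) (𝓡 4) f w (1 : ℂ))) z 1) ^ 2 +
              (fderiv ℝ (fun w => F (f w) (mfderiv 𝓘(ℝ, ℂ) (𝓡 4) f w (1 : ℂ))) z Complex.I) ^ 2)) := by
  intro S p J ε' F c q r₁ r₃ hdata r₂ c' Jh' Fh' hr₁₂ hr₂₃ hc' hJh' hJh'2 hFh'pos hcert' hlink
  obtain ⟨hε', hballp, hJ2, hJs, hJstd, hc, -, -, hballq, -, hcore, -, hFpos, hcert⟩ := hdata
  classical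
  /- the chart `e = e_q`, the chart map `Φ = e ∘ val` on `Σ ∖ p`, the coframe `A_x = dΦ_x` read
  as an endomorphism of `ℝ⁴`, the open piece `D₃ = Φ⁻¹ B(e q, r₃)`, the closed `C = Φ⁻¹ B̄(r₂)` -/
  set e := extChartAt (𝓡 4) q with he
  set Φ := fun z : ↥(punctured p) => e z.1
  set A : ↥(punctured p) → EuclideanSpace ℝ (Fin 4) →L[ℝ] EuclideanSpace ℝ (Fin 4) :=
    fun x => mfderiv (𝓡 4) (𝓡 4) Φ x
  set D₃ : Set ↥(punctured p) := {x | x.1 ∈ e.source ∧ e x.1 ∈ Metric.ball (e q) r₃}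
  set C : Set ↥(punctured p) := Subtype.val ⁻¹' (e.symm '' Metric.closedBall (e q) r₂)
  have hsrc := fun (x : ↥(punctured p)) (hx : x.1 ∈ e.source) =>
    show x.1 ∈ (chartAt (EuclideanSpace ℝ (Fin 4)) q).source by rwa [he, extChartAt_source] at hx
  have hD₃o : IsOpen D₃ := ((continuousOn_extChartAt q).isOpen_inter_preimage
    (isOpen_extChartAt_source q) Metric.isOpen_ball).preimage continuous_subtype_val
  have hCc : IsClosed C :=
    ((isCompact_closedBall _ _).image_of_continuousOn ((continuousOn_extChartAt_symm q).mono
      ((Metric.closedBall_subset_closedBall hr₂₃.le).trans hballq))).isClosed.preimage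
      continuous_subtype_val
  have hunion : ∀ x : ↥(punctured p), x ∈ Cᶜ ∨ x ∈ D₃ := fun x => by
    refine (em (x ∈ C)).symm.imp_right ?_
    rintro ⟨y, hy, hyx⟩
    have hyT := hballq (Metric.closedBall_subset_closedBall hr₂₃.le hy)
    refine ⟨?_, ?_⟩
    · rw [← hyx]; exact e.map_target hyT
    · rw [← hyx, e.right_inv hyT]; exact Metric.closedBall_subset_ball hr₂₃ hy
  have hΦs : ∀ x : ↥(punctured p), x.1 ∈ e.source → ContMDiffAt (𝓡 4) (𝓡 4) ∞ Φ x :=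
    fun x hx => contMDiffAt_extChartAt_comp_val p q hx
  have hAinv : ∀ x : ↥(punctured p), x.1 ∈ e.source → (A x).IsInvertible :=
    fun x hx => isInvertible_mfderiv_extChartAt_comp_val p q hx
  /- the glued pair: `K = A⁻¹ Ĵ'(e ·) A` and `F̂'(e ·)(A ·)` on `D₃`, `(J, F)` off `D₃` -/
  set K : ↥(punctured p) → EuclideanSpace ℝ (Fin 4) →L[ℝ] EuclideanSpace ℝ (Fin 4) :=
    fun x => (A x).inverse ∘L Jh' (e x.1) ∘L A x
  set J'' : ∀ x : ↥(punctured p), TangentSpace (𝓡 4) x →L[ℝ] TangentSpace (𝓡 4) x :=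
    fun x => if x ∈ D₃ then K x else J x
  set F'' : ∀ x : ↥(punctured p), TangentSpace (𝓡 4) x → ℝ :=
    fun x v => if x ∈ D₃ then Fh' (e x.1) (A x v) else F x v
  have hJ''D : ∀ x ∈ D₃, J'' x = K x := fun x hx => if_pos hx
  have hJ''T₀ : ∀ x ∉ D₃, J'' x = J x := fun x hx => if_neg hx
  have hF''D : ∀ x ∈ D₃, ∀ v, F'' x v = Fh' (e x.1) (A x v) := fun x hx v => if_pos hx
  have hF''T₀ : ∀ x ∉ D₃, ∀ v, F'' x v = F x v := fun x hx v => if_neg hx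
  -- by the link, the two branches agree on `D₃ ∖ C`, so the glued pair is `(J, F)` off `C`
  have hlink' : ∀ x ∈ D₃, x ∈ Cᶜ → ∀ v : TangentSpace (𝓡 4) x,
      Jh' (e x.1) (A x v) = A x (J x v) ∧ Fh' (e x.1) (A x v) = F x v :=
    fun x hD hx v => hlink x (hsrc x hD.1) ⟨hD.2, fun hb => hx ⟨_, hb, e.left_inv hD.1⟩⟩ v
  have hJ''T : ∀ x ∈ Cᶜ, J'' x = J x := by
    intro x hx
    by_cases hD : x ∈ D₃
    · rw [hJ''D x hD]
      refine ContinuousLinearMap.ext fun v => ?_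
      show (A x).inverse (Jh' (e x.1) (A x v)) = J x v
      rw [(hlink' x hD hx v).1, (hAinv x hD.1).inverse_apply_self]
    · exact hJ''T₀ x hD
  have hF''T : ∀ x ∈ Cᶜ, ∀ v, F'' x v = F x v := by
    intro x hx v
    by_cases hD : x ∈ D₃
    · rw [hF''D x hD]; exact (hlink' x hD hx v).2
    · exact hF''T₀ x hD v
  refine ⟨J'', ε', min c c', F'', hε', hballp, ?_, ?_, ?_, lt_min hc hc', ?_, ?_⟩
  · intro x v -- `J''² = -1`
    by_cases hx : x ∈ D₃
    · rw [hJ''D x hx]; exact conj_conj (hJh'2 _ hx.2) (hAinv x hx.1) v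
    · rw [hJ''T₀ x hx]; exact hJ2 x v
  · intro x₀ -- smoothness: locally `J''` is `J` (off `C`) or the conjugate of the flat field
    rcases hunion x₀ with hT | hD
    · exact contMDiffAt_inTangentCoordinates_congr_of_isOpen hCc.isOpen_compl hT hJ''T (hJs x₀)
    · have hj : ContMDiffAt (𝓡 4) 𝓘(ℝ, EuclideanSpace ℝ (Fin 4) →L[ℝ] EuclideanSpace ℝ (Fin 4))
          ∞ (fun x : ↥(punctured p) => Jh' (e x.1)) x₀ :=
        ContDiffAt.comp_contMDiffAt (f := Φ)
          (hJh'.contDiffAt (Metric.isOpen_ball.mem_nhds hD.2)) (hΦs x₀ hD.1)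
      exact contMDiffAt_inTangentCoordinates_congr_of_isOpen hD₃o hD hJ''D
        (contMDiffAt_inTangentCoordinates_conj_field (I := 𝓡 4)
          (fun x : ↥(punctured p) => Jh' (e x.1)) A Φ hj ((hΦs x₀ hD.1).mfderiv_const (by simp))
          (hAinv x₀ hD.1))
  · intro x hx v b -- standard on `B_ε'`: the chart ball misses the collar, `J'' = J` there
    rw [hJ''T₀ x fun hD => hcore x (hsrc x hD.1) (Metric.ball_subset_closedBall hD.2) hx]
    exact hJstd x hx v b
  · intro x _ v -- `F''` is positive definite (`A_x` is injective on `D₃`)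
    by_cases hx : x ∈ D₃
    · rw [hF''D x hx]
      obtain ⟨h0, h1⟩ := hFh'pos _ hx.2 (A x v)
      exact ⟨h0, fun h => (hAinv x hx.1).injective ((h1 h).trans (map_zero (A x)).symm)⟩
    · rw [hF''T₀ x hx]; exact hFpos x v
  · intro U f hU hf hhol havoid -- the certificate along a local `J''`-curve `f : U → core`
    -- piece 1: on `U₁ = U ∩ f⁻¹(Cᶜ)`, `f` is a `J`-curve avoiding the inner ball
    have hU₁o : IsOpen (U ∩ f ⁻¹' Cᶜ) := hf.continuousOn.isOpen_inter_preimage hU hCc.isOpen_compl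
    obtain ⟨hC₁, hineq₁⟩ := hcert (U ∩ f ⁻¹' Cᶜ) f hU₁o (hf.mono inter_subset_left)
      (fun z hz ζ => by rw [hhol z hz.1 ζ, hJ''T (f z) hz.2]) (fun z hz => havoid z hz.1)
      (fun z hz hs hb => hz.2 ⟨_, Metric.closedBall_subset_closedBall hr₁₂.le hb,
        e.left_inv (by rwa [he, extChartAt_source])⟩)
    -- piece 2: on `U₂ = U ∩ f⁻¹(D₃)`, `g = e ∘ f` is a flat `Ĵ'`-curve into the ball
    obtain ⟨hU₂o, hg, hchain⟩ :=
      contDiffOn_extChartAt_comp_jcurve p q hU hf hD₃o (fun x hx => hx.1)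
    have hchain' : ∀ z ∈ U ∩ f ⁻¹' D₃, ∀ ζ : ℂ,
        fderiv ℝ (fun w => e (f w).1) z ζ = A (f z) (mfderiv 𝓘(ℝ, ℂ) (𝓡 4) f z ζ) := hchain
    obtain ⟨hC₂, hineq₂⟩ := hcert' (U ∩ f ⁻¹' D₃) (fun w => e (f w).1) hU₂o hg
      (fun z hz ζ => by
        rw [hchain' z hz, hchain' z hz, hhol z hz.1 ζ, hJ''D (f z) hz.2]
        exact apply_conj (hAinv (f z) hz.2.1) _)
      (fun z hz => hz.2.2)
    refine certificate_glue_of_cover hU₁o hU₂o (fun z hz => ?_) hC₁ hC₂ hineq₁ hineq₂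
      (fun w hw => hF''T (f w) hw.2 _) (fun w hw => ?_) (fun z _ => (hFpos _ _).1)
      (fun z hz => (hFh'pos _ hz.2.2 _).1)
    · exact (hunion (f z)).imp (fun h => ⟨hz, h⟩) (fun h => ⟨hz, h⟩)
    · show F'' (f w) _ = Fh' _ (fderiv ℝ (fun w => e (f w).1) w 1)
      rw [hF''D (f w) hw.2, hchain' w hw]


end Summit.SmoothPoincare4.SmoothPoincare4.Cruxes.HyperbolicEnd.Sketch

end
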